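import Mathlib.LinearAlgebra.Dual.Lemmas
import Mathlib.LinearAlgebra.Matrix.NonsingularInverse
import Mathlib.Data.Matrix.Mul
import Mathlib.LinearAlgebra.Matrix.Symmetric
import Mathlib.Tactic.LinearCombination
import Mathlib.Tactic.Module
import HarnessLib

/-!
# Three elementary facts on symmetric bilinear forms in coordinates: dual vectors of an independent pair, a symmetric
# matrix with two prescribed values, and the hyperbolic partner of an isotropic vector

Topic `LinearAlgebra`; namespace `Literature.LinearAlgebra`.  KERNEL ONLY: theorems over Mathlib (no definition, no
named fact, no `sorry`), in the coordinates `ι → K` / `Matrix ι ι K` used by the tree's Heisenberg–Weil files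
(`Matrix.toLinearMap₂'`, `dotProduct`, `mulVec`).

* `exists_dual_pair` — for `a, b ∈ K^ι` linearly independent there are `a', b' ∈ K^ι` with
  `a'·a = 1, a'·b = 0, b'·a = 0, b'·b = 1` (dual basis of the plane `⟨a, b⟩`, [Lam2005, Ch. I §2]).
* `exists_isSymm_mulVec_eq_mulVec_eq` — for `a, b` linearly independent and `p, q` with the (necessary) compatibility
  `a·q = b·p`, there is a SYMMETRIC matrix `S` with `S a = p`, `S b = q` (a symmetric bilinear form with prescribed
  partial Gram data on an independent pair extends to the whole space, [Lam2005, Ch. I §2]); explicitly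
  `S = p⊗a' + a'⊗p - (p·a) a'⊗a' + q⊗b' + b'⊗q - (q·b) b'⊗b' - (p·b)(a'⊗b' + b'⊗a')`.
* `exists_hyperbolic_partner` — for `T` symmetric with `det T` a unit, `2` invertible, and `b ≠ 0` ISOTROPIC
  (`b·Tb = 0`), there is an isotropic `c` with `b·Tc = 1`: every isotropic vector of a regular quadratic space lies in
  a hyperbolic plane ([Serre1973, Ch. IV §1.3, Prop. 3]; [Lam2005, Ch. I §3, Thm. 3.4]).

Consumer: `RepresentationTheory/MoeglinVignerasWaldspurger1987/RankOneThetaLiftIsotropicLine.lean` (an isotropic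
`E_v`-line of a hermitian space in general position and the Lagrangian graph containing it).

## References
* [Serre1973] J.-P. Serre, *A Course in Arithmetic*, GTM 7 (1973), Ch. IV §1.3, Prop. 3 and its corollary.
* [Lam2005] T. Y. Lam, *Introduction to Quadratic Forms over Fields*, GSM 67 (2005), Ch. I §2 (Gram matrices), §3
  Thm. 3.4 (hyperbolic pairs).
-/

set_option autoImplicit false

namespace Literature.LinearAlgebra

open Matrix

variable {K : Type*} [Field K] {ι : Type*} [Fintype ι] [DecidableEq ι]

/-- a linear form on `K^ι` is `u ↦ a' · u` for the vector `a' = (f eᵢ)ᵢ`. [cite: Lam2005, Ch. I §2] -/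
private theorem exists_dotProduct_eq_dual (f : Module.Dual K (ι → K)) : ∃ a' : ι → K, ∀ u, a' ⬝ᵥ u = f u := by
  refine ⟨fun i => f fun j => if i = j then 1 else 0, fun u => ?_⟩
  rw [LinearMap.pi_apply_eq_sum_univ f u, dotProduct]
  exact Finset.sum_congr rfl fun i _ => by rw [smul_eq_mul, mul_comm]

/-- **dual vectors of an independent pair**: for `a, b` linearly independent in `K^ι` there are `a', b'` with
`a'·a = 1`, `a'·b = 0`, `b'·a = 0`, `b'·b = 1`. [cite: Lam2005, Ch. I §2] -/
theorem exists_dual_pair {a b : ι → K} (hab : LinearIndependent K ![a, b]) :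
    ∃ a' b' : ι → K, a' ⬝ᵥ a = 1 ∧ a' ⬝ᵥ b = 0 ∧ b' ⬝ᵥ a = 0 ∧ b' ⬝ᵥ b = 1 := by
  have hpair := LinearIndependent.pair_iff.1 hab
  -- `a ∉ K b` and `b ∉ K a`
  have ha : a ∉ (K ∙ b) := by
    intro h
    obtain ⟨t, ht⟩ := Submodule.mem_span_singleton.1 h
    have := hpair (-1) t (by rw [← ht]; module)
    exact one_ne_zero (neg_eq_zero.1 this.1)
  have hb : b ∉ (K ∙ a) := by
    intro h
    obtain ⟨t, ht⟩ := Submodule.mem_span_singleton.1 h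
    have := hpair t (-1) (by rw [← ht]; module)
    exact one_ne_zero (neg_eq_zero.1 this.2)
  obtain ⟨f, hfa, hfb⟩ := Submodule.exists_dual_map_eq_bot_of_notMem ha inferInstance
  obtain ⟨g, hgb, hga⟩ := Submodule.exists_dual_map_eq_bot_of_notMem hb inferInstance
  have hfb' : f b = 0 := by
    have : f b ∈ (K ∙ b).map f := ⟨b, Submodule.mem_span_singleton_self b, rfl⟩
    rw [hfb] at this
    exact (Submodule.mem_bot K).1 this
  have hga' : g a = 0 := by
    have : g a ∈ (K ∙ a).map g := ⟨a, Submodule.mem_span_singleton_self a, rfl⟩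
    rw [hga] at this
    exact (Submodule.mem_bot K).1 this
  obtain ⟨a₁, ha₁⟩ := exists_dotProduct_eq_dual ((f a)⁻¹ • f)
  obtain ⟨b₁, hb₁⟩ := exists_dotProduct_eq_dual ((g b)⁻¹ • g)
  refine ⟨a₁, b₁, ?_, ?_, ?_, ?_⟩
  · rw [ha₁, LinearMap.smul_apply, smul_eq_mul, inv_mul_cancel₀ hfa]
  · rw [ha₁, LinearMap.smul_apply, smul_eq_mul, hfb', mul_zero]
  · rw [hb₁, LinearMap.smul_apply, smul_eq_mul, hga', mul_zero]
  · rw [hb₁, LinearMap.smul_apply, smul_eq_mul, inv_mul_cancel₀ hgb]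

omit [DecidableEq ι] in
/-- `(u ⊗ v) w = (v·w) u` over a commutative ring (Mathlib's `vecMulVec_mulVec` without `MulOpposite`). [folklore] -/
private theorem vecMulVec_mulVec' (u v w : ι → K) : vecMulVec u v *ᵥ w = (v ⬝ᵥ w) • u := by
  rw [vecMulVec_mulVec, op_smul_eq_smul]

omit [DecidableEq ι] in
/-- **a symmetric matrix with two prescribed values**: for `a, b` linearly independent in `K^ι` and `p, q` with
`a·q = b·p` there is a symmetric `S ∈ M_ι(K)` with `S a = p` and `S b = q`. [cite: Lam2005, Ch. I §2] -/
theorem exists_isSymm_mulVec_eq_mulVec_eq [DecidableEq ι] {a b : ι → K} (hab : LinearIndependent K ![a, b])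
    (p q : ι → K) (hpq : a ⬝ᵥ q = b ⬝ᵥ p) :
    ∃ S : Matrix ι ι K, S.IsSymm ∧ S *ᵥ a = p ∧ S *ᵥ b = q := by
  obtain ⟨a', b', ha'a, ha'b, hb'a, hb'b⟩ := exists_dual_pair hab
  refine ⟨vecMulVec p a' + vecMulVec a' p - (p ⬝ᵥ a) • vecMulVec a' a' + vecMulVec q b' + vecMulVec b' q -
      (q ⬝ᵥ b) • vecMulVec b' b' - (p ⬝ᵥ b) • (vecMulVec a' b' + vecMulVec b' a'), ?_, ?_, ?_⟩
  · -- symmetry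
    simp only [Matrix.IsSymm, transpose_add, transpose_sub, transpose_smul, transpose_vecMulVec]
    abel
  · -- value at `a`
    have hqa : q ⬝ᵥ a = p ⬝ᵥ b := by rw [dotProduct_comm, hpq, dotProduct_comm]
    simp only [add_mulVec, sub_mulVec, smul_mulVec, vecMulVec_mulVec', ha'a, hb'a, hqa, one_smul,
      zero_smul, add_zero]
    module
  · -- value at `b`
    simp only [add_mulVec, sub_mulVec, smul_mulVec, vecMulVec_mulVec', ha'b, hb'b, one_smul, zero_smul,
      zero_add]
    module

omit [DecidableEq ι] in
/-- for a symmetric `T`, `b · (T c) = (T b) · c`. [folklore] -/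
private theorem dotProduct_mulVec_of_isSymm {T : Matrix ι ι K} (hT : T.IsSymm) (b c : ι → K) :
    b ⬝ᵥ T *ᵥ c = (T *ᵥ b) ⬝ᵥ c := by
  rw [dotProduct_mulVec, ← vecMul_transpose, hT]

/-- **hyperbolic partner of an isotropic vector**: `T` symmetric with `det T` a unit, `2` invertible in `K`; if
`b ≠ 0` and `b·Tb = 0` then some `c` has `b·Tc = 1` and `c·Tc = 0` (so `⟨b, c⟩` is a hyperbolic plane).
[cite: Serre1973, Ch. IV §1.3, Prop. 3] -/
theorem exists_hyperbolic_partner [Invertible (2 : K)] {T : Matrix ι ι K} (hT : T.IsSymm) (hTd : IsUnit T.det)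
    {b : ι → K} (hb : b ≠ 0) (hbb : b ⬝ᵥ T *ᵥ b = 0) :
    ∃ c : ι → K, b ⬝ᵥ T *ᵥ c = 1 ∧ c ⬝ᵥ T *ᵥ c = 0 := by
  -- `T b ≠ 0`, so some coordinate `(T b) i ≠ 0`
  have hTb : T *ᵥ b ≠ 0 := fun h => hb ((Matrix.mulVec_injective_iff_isUnit.2
    ((Matrix.isUnit_iff_isUnit_det T).2 hTd)) (by rw [h, mulVec_zero]))
  obtain ⟨i, hi⟩ : ∃ i, (T *ᵥ b) i ≠ 0 := by
    by_contra h
    exact hTb (funext fun i => not_not.1 fun hi => h ⟨i, hi⟩)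
  -- `c₀` with `b·T c₀ = 1`
  set c₀ : ι → K := Pi.single i ((T *ᵥ b) i)⁻¹ with hc₀
  have hbc₀ : b ⬝ᵥ T *ᵥ c₀ = 1 := by
    rw [dotProduct_mulVec_of_isSymm hT, hc₀, dotProduct_single, mul_inv_cancel₀ hi]
  have hc₀b : c₀ ⬝ᵥ T *ᵥ b = 1 := by
    rw [dotProduct_mulVec_of_isSymm hT, dotProduct_comm]
    exact hbc₀
  -- correct by a multiple of `b`
  refine ⟨c₀ - (⅟(2 : K) * (c₀ ⬝ᵥ T *ᵥ c₀)) • b, ?_, ?_⟩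
  · rw [mulVec_sub, mulVec_smul, dotProduct_sub, dotProduct_smul, hbc₀, hbb, smul_eq_mul, mul_zero, sub_zero]
  · have h2 : (⅟(2 : K)) * 2 = 1 := invOf_mul_self _
    rw [mulVec_sub, mulVec_smul, sub_dotProduct, dotProduct_sub, dotProduct_sub, smul_dotProduct, smul_dotProduct,
      dotProduct_smul, dotProduct_smul, hbc₀, hc₀b, hbb]
    simp only [smul_eq_mul, mul_one, mul_zero, sub_zero]
    linear_combination (-(c₀ ⬝ᵥ T *ᵥ c₀)) * h2

end Literature.LinearAlgebra
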